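import Mathlib
import Summits.ValiantsHypothesis.ValiantsHypothesis.Theorems.RigidityForcesSymmetryRankRigidMinimalReprLaplaceDefs
import Summits.ValiantsHypothesis.ValiantsHypothesis.Theorems.RigidityForcesSymmetryRankRigidMinimalReprLaplaceFourDefs
import Summits.ValiantsHypothesis.ValiantsHypothesis.Theorems.RigidityForcesSymmetryRankRigidMinimalReprLaplaceFourContraction
import Summits.ValiantsHypothesis.ValiantsHypothesis.Theorems.RigidityForcesSymmetryRankRigidMinimalReprLaplaceFourSlices
import Summits.ValiantsHypothesis.ValiantsHypothesis.Theorems.RigidityForcesSymmetryRankRigidMinimalReprLaplaceFourFlat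
import Summits.ValiantsHypothesis.ValiantsHypothesis.Theorems.RigidityForcesSymmetryRankRigidMinimalReprLaplaceFourLinePsi
import Summits.ValiantsHypothesis.ValiantsHypothesis.Theorems.RigidityForcesSymmetryRankRigidMinimalReprLaplaceFourAssembly

/-!
# `LaplaceOptimal 4` from the last open profile `(2,2,1)` (assembly, part 2)
# (crux `RankRigidMinimalRepr`, stmt-ValiantsHypothesis-18034, route `RigidityForcesSymmetry`)

`laplaceOptimal_four_of_profile221`: IF the profile `(2,2,1)` (two pair terms on `01|23`, two on `02|13`, one on
`03|12`) cannot represent `P₄`, THEN `LaplaceOptimal 4` holds.  All other cheap profiles are refuted in the tree: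
`laplace_four_at_most_one_slice` (≥ 2 slices), `profile_500`, `profile_400s`, `line_profile_psi` (`(3,2,0)`,
`slice+(2,2,0)`, `slice+(3,1,0)`), `profile_311_fin`, `profile_211s_fin`, `profile_410_fin`.

The reduction: types of the terms (`LaplaceFourSlices.classify`), the profile `n : Fin 7 → ℕ`, at most one slice
(Theorem E), a finite search (`orient_one`, `decide`) for a slot relabelling `σ` carrying the profile into one of nine
canonical capped profiles, transport (`slotPerm`), and the profile theorems.

HONEST FRAMING: `LaplaceOptimal 4` is the finite input of the rung `TiedTorusBound 3` of the crux; the crux itself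
stays OPEN; nothing here bears on `VP ≠ VNP`.
-/

set_option autoImplicit false

-- the mandated summit-side namespace repeats a component by design (single-problem summit)
set_option linter.dupNamespace false

namespace Summit.ValiantsHypothesis.ValiantsHypothesis.Theorems.RigidityForcesSymmetryRankRigidMinimalRepr

namespace LaplaceFourLine

open Matrix LaplaceFourContraction LaplaceFourSlices LaplaceFourFlat LaplaceFourEasy

/-! ### §1 The finite search -/

/-- THE FINITE SEARCH.  Every profile with at most one slice and Laplace weight `< 24` is carried by a slot
relabelling `σ` into one of nine capped canonical profiles (caps per type `{0},{1},{2},{3},{0,1},{0,2},{0,3}`):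
`(5,0,0)`, `slice+(4,0,0)`, the three `ψ`-type LINE profiles, `(3,1,1)`, `slice+(2,1,1)`, `(4,1,0)`, `(2,2,1)`. -/
theorem orient_one : ∀ (sl : Fin 4 → Fin 2) (pr : Fin 3 → Fin 6),
    (sl 0 : ℕ) + sl 1 + sl 2 + sl 3 ≤ 1 →
    6 * ((sl 0 : ℕ) + sl 1 + sl 2 + sl 3) + 4 * ((pr 0 : ℕ) + pr 1 + pr 2) < 24 →
    ∃ σ : Equiv.Perm (Fin 4), ∃ j : Fin 9, ∀ τ : Fin 7,
      (∑ i : Fin 4, if act σ (Fin.castAdd 3 i) = τ then (sl i : ℕ) else 0) +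
        (∑ k : Fin 3, if act σ (Fin.natAdd 4 k) = τ then (pr k : ℕ) else 0) ≤
      (![![0, 0, 0, 0, 5, 0, 0], ![1, 0, 0, 0, 4, 0, 0], ![0, 0, 0, 0, 3, 2, 0], ![1, 0, 0, 0, 2, 2, 0],
          ![0, 0, 1, 0, 3, 1, 0], ![0, 0, 0, 0, 3, 1, 1], ![1, 0, 0, 0, 2, 1, 1], ![0, 0, 0, 0, 4, 1, 0],
          ![0, 0, 0, 0, 2, 2, 1]] : Fin 9 → Fin 7 → ℕ) j τ := by
  decide +kernel

/-- `rep` is injective. -/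
theorem rep_inj : ∀ τ τ' : Fin 7, rep τ = rep τ' ↔ τ = τ' := by
  decide +kernel

/-- Slices are exactly the types `< 4`. -/
theorem card_of_type_lt_four : ∀ (A : Finset (Fin 4)) (τ : Fin 7), (A = rep τ ∨ Aᶜ = rep τ) → (τ : ℕ) < 4 →
    (A.card = 1 ∨ A.card = 3) := by
  decide +kernel

/-! ### §2 `LaplaceOptimal 4` from the profile `(2,2,1)` -/

/-- **`LaplaceOptimal 4`, conditionally on the last profile.**  If `P₄` is not a sum of two pair terms on `01|23`, two
on `02|13` and one on `03|12` (the profile `(2,2,1)`, array form), then every split-rank-one decomposition of the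
`4 × 4` permutation pattern has Laplace weight `Σ_t |S_t|!(4-|S_t|)! ≥ 24 = 4!`. -/
theorem laplaceOptimal_four_of_profile221
    (H221 : ∀ (g h b b' : Fin 2 → Fin 4 → Fin 4 → ℂ) (c c' : Fin 4 → Fin 4 → ℂ),
      (∀ v, permPattern₄ v = (∑ t, g t (v 0) (v 1) * h t (v 2) (v 3)) + (∑ k, b k (v 0) (v 2) * b' k (v 1) (v 3)) +
        c (v 0) (v 3) * c' (v 1) (v 2)) → False) :
    LaplaceOptimal 4 := by
  classical
  intro N T S u w hu hw hsum
  by_contra hlt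
  push Not at hlt
  -- every term has an admissible dependence set, hence a type
  have hcard : ∀ t ∈ T, (S t).card = 1 ∨ (S t).card = 2 ∨ (S t).card = 3 := fun t ht =>
    card_of_weight_lt _ ((Finset.single_le_sum (f := fun t => (S t).card.factorial * (4 - (S t).card).factorial)
      (fun _ _ => Nat.zero_le _) ht).trans_lt hlt)
  have hcl : ∀ t, ∃ τ : Fin 7, t ∈ T → (S t = rep τ ∨ (S t)ᶜ = rep τ) := fun t => by
    by_cases ht : t ∈ T
    · obtain ⟨τ, hτ⟩ := classify (S t) (hcard t ht); exact ⟨τ, fun _ => hτ⟩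
    · exact ⟨0, fun h => absurd h ht⟩
  choose ty hty using hcl
  -- the profile
  set n : Fin 7 → ℕ := fun τ => (T.filter fun t => ty t = τ).card with hn
  have hfib : ∀ (P : Fin 7 → Prop) [DecidablePred P],
      (T.filter fun t => P (ty t)).card = ∑ τ, if P τ then n τ else 0 := by
    intro P _
    rw [Finset.card_eq_sum_card_fiberwise (f := ty) (t := Finset.univ) (fun _ _ => Finset.mem_univ _)]
    refine Finset.sum_congr rfl fun τ _ => ?_
    split_ifs with hP
    · rw [hn]; congr 1; ext t; simp only [Finset.mem_filter]; constructor
      · rintro ⟨⟨ht, -⟩, rfl⟩; exact ⟨ht, rfl⟩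
      · rintro ⟨ht, rfl⟩; exact ⟨⟨ht, hP⟩, rfl⟩
    · rw [Finset.card_eq_zero, Finset.filter_eq_empty_iff]
      rintro t ht
      rw [Finset.mem_filter] at ht
      rintro rfl; exact hP ht.2
  -- the weight in terms of the profile
  have hW : ∑ t ∈ T, (S t).card.factorial * (4 - (S t).card).factorial =
      ∑ τ, n τ * (if (τ : ℕ) < 4 then 6 else 4) := by
    rw [← Finset.sum_fiberwise_of_maps_to (s := T) (t := Finset.univ) (g := ty) (fun _ _ => Finset.mem_univ _)]
    refine Finset.sum_congr rfl fun τ _ => ?_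
    rw [Finset.sum_congr rfl fun t ht => ?_, Finset.sum_const, smul_eq_mul]
    rw [Finset.mem_filter] at ht
    rw [weight_of_type (S t) (ty t) (hty t ht.1), ht.2]
  have hW' : ∑ τ, n τ * (if (τ : ℕ) < 4 then 6 else 4) = 6 * (n 0 + n 1 + n 2 + n 3) + 4 * (n 4 + n 5 + n 6) := by
    simp [Fin.sum_univ_seven]; ring
  have hlt' : 6 * (n 0 + n 1 + n 2 + n 3) + 4 * (n 4 + n 5 + n 6) < 24 := by rw [← hW', ← hW]; exact hlt
  -- at most one slice (Theorem E)
  have hsl : n 0 + n 1 + n 2 + n 3 ≤ 1 := by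
    by_contra h2
    push Not at h2
    have h2' : 1 < (T.filter fun t => (ty t : ℕ) < 4).card := by
      rw [hfib (fun τ => (τ : ℕ) < 4)]
      simp [Fin.sum_univ_seven]
      omega
    obtain ⟨t₁, ht₁, t₂, ht₂, hne⟩ := Finset.one_lt_card.1 h2'
    rw [Finset.mem_filter] at ht₁ ht₂
    exact laplace_four_at_most_one_slice T S u w hu hw hsum hlt ht₁.1 ht₂.1 hne
      (card_of_type_lt_four _ _ (hty _ ht₁.1) ht₁.2) (card_of_type_lt_four _ _ (hty _ ht₂.1) ht₂.2)
  -- the finite search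
  have hb1 : ∀ i : Fin 4, n (Fin.castAdd 3 i) < 2 := fun i => by fin_cases i <;> simp <;> omega
  have hb2 : ∀ k : Fin 3, n (Fin.natAdd 4 k) < 6 := fun k => by fin_cases k <;> simp <;> omega
  obtain ⟨σ, j, hj⟩ := orient_one (fun i => ⟨n (Fin.castAdd 3 i), hb1 i⟩) (fun k => ⟨n (Fin.natAdd 4 k), hb2 k⟩)
    (by simpa using hsl) (by simpa using hlt')
  -- counts of the transported types
  have hcount : ∀ τ, (T.filter fun t => act σ (ty t) = τ).card ≤ (![![0, 0, 0, 0, 5, 0, 0], ![1, 0, 0, 0, 4, 0, 0],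
      ![0, 0, 0, 0, 3, 2, 0], ![1, 0, 0, 0, 2, 2, 0], ![0, 0, 1, 0, 3, 1, 0], ![0, 0, 0, 0, 3, 1, 1],
      ![1, 0, 0, 0, 2, 1, 1], ![0, 0, 0, 0, 4, 1, 0], ![0, 0, 0, 0, 2, 2, 1]] : Fin 9 → Fin 7 → ℕ) j τ := by
    intro τ
    have e : ∀ f : Fin 7 → ℕ, (∑ τ' : Fin 7, f τ') = (∑ i : Fin 4, f (Fin.castAdd 3 i)) + ∑ k : Fin 3, f (Fin.natAdd 4 k) :=
      fun f => Fin.sum_univ_add (a := 4) (b := 3) f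
    rw [hfib (fun τ' => act σ τ' = τ), e]
    exact hj τ
  -- transport along `σ`
  have hterm : ∀ t ∈ T, IsSplitTerm (rep (ty t)) (fun v => u t v * w t v) := by
    intro t ht
    have h0 : IsSplitTerm (S t) (fun v => u t v * w t v) :=
      ⟨u t, w t, hu t, fun v v' h => hw t v v' fun i hi => h i (Finset.mem_compl.2 hi), fun _ => rfl⟩
    rcases hty t ht with h | h
    · rw [← h]; exact h0
    · rw [← h]; exact isSplitTerm_compl h0
  have hX' : ∀ t ∈ T, IsSplitTerm (rep (act σ (ty t))) (slotPerm σ fun v => u t v * w t v) := by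
    intro t ht
    have h1 := isSplitTerm_slotPerm σ (hterm t ht)
    rcases rep_map σ (ty t) with h | h
    · rw [← h]; exact h1
    · rw [← h]; exact isSplitTerm_compl h1
  have hsum' : ∀ v, permPattern₄ v = ∑ t ∈ T, slotPerm σ (fun v => u t v * w t v) v := by
    intro v
    have := congrFun (slotPerm_permPattern σ) v
    rw [← this]
    simp only [slotPerm, permPattern₄, ← hsum]
  set X' : Fin N → (Fin 4 → Fin 4) → ℂ := fun t => slotPerm σ fun v => u t v * w t v with hX'def
  set S' : Fin N → Finset (Fin 4) := fun t => rep (act σ (ty t)) with hS'def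
  have hcnt : ∀ τ₀ : Fin 7, (T.filter fun t => S' t = rep τ₀).card ≤ (![![0, 0, 0, 0, 5, 0, 0],
      ![1, 0, 0, 0, 4, 0, 0], ![0, 0, 0, 0, 3, 2, 0], ![1, 0, 0, 0, 2, 2, 0], ![0, 0, 1, 0, 3, 1, 0],
      ![0, 0, 0, 0, 3, 1, 1], ![1, 0, 0, 0, 2, 1, 1], ![0, 0, 0, 0, 4, 1, 0], ![0, 0, 0, 0, 2, 2, 1]] :
      Fin 9 → Fin 7 → ℕ) j τ₀ := by
    intro τ₀
    rw [Finset.filter_congr (fun t _ => rep_inj (act σ (ty t)) τ₀)]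
    exact hcount τ₀
  have htype : ∀ t ∈ T, (![![0, 0, 0, 0, 5, 0, 0], ![1, 0, 0, 0, 4, 0, 0], ![0, 0, 0, 0, 3, 2, 0],
      ![1, 0, 0, 0, 2, 2, 0], ![0, 0, 1, 0, 3, 1, 0], ![0, 0, 0, 0, 3, 1, 1], ![1, 0, 0, 0, 2, 1, 1],
      ![0, 0, 0, 0, 4, 1, 0], ![0, 0, 0, 0, 2, 2, 1]] : Fin 9 → Fin 7 → ℕ) j (act σ (ty t)) ≠ 0 := by
    intro t ht h0
    have h1 : 0 < (T.filter fun t' => act σ (ty t') = act σ (ty t)).card :=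
      Finset.card_pos.2 ⟨t, Finset.mem_filter.2 ⟨ht, rfl⟩⟩
    have h2 := hcount (act σ (ty t))
    omega
  -- explicit canonical sets
  have r0 : rep 0 = {0} := rfl
  have r2 : rep 2 = {2} := rfl
  have r4 : rep 4 = {0, 1} := rfl
  have r5 : rep 5 = {0, 2} := rfl
  have r6 : rep 6 = {0, 3} := rfl
  -- the nine canonical profiles
  have hS'ty : ∀ t ∈ T, ∃ τ, S' t = rep τ ∧ (![![0, 0, 0, 0, 5, 0, 0], ![1, 0, 0, 0, 4, 0, 0],
      ![0, 0, 0, 0, 3, 2, 0], ![1, 0, 0, 0, 2, 2, 0], ![0, 0, 1, 0, 3, 1, 0], ![0, 0, 0, 0, 3, 1, 1],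
      ![1, 0, 0, 0, 2, 1, 1], ![0, 0, 0, 0, 4, 1, 0], ![0, 0, 0, 0, 2, 2, 1]] : Fin 9 → Fin 7 → ℕ) j τ ≠ 0 :=
    fun t ht => ⟨_, rfl, htype t ht⟩
  have hc0 := hcnt 0
  have hc2 := hcnt 2
  have hc4 := hcnt 4
  have hc5 := hcnt 5
  have hc6 := hcnt 6
  rw [r0] at hc0
  rw [r2] at hc2
  rw [r4] at hc4
  rw [r5] at hc5
  rw [r6] at hc6
  fin_cases j <;> simp only [Fin.isValue, Fin.mk_one, Fin.zero_eta, Fin.reduceFinMk, Matrix.cons_val_zero,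
    Matrix.cons_val_one, Matrix.cons_val_two, Matrix.cons_val_three, Matrix.cons_val_four, Matrix.cons_val,
    Matrix.head_cons, Matrix.tail_cons] at hc0 hc2 hc4 hc5 hc6 hS'ty
  · -- (5,0,0)
    have hS' : ∀ t ∈ T, S' t = {0, 1} := by
      intro t ht; obtain ⟨τ, hτ, hc⟩ := hS'ty t ht; rw [hτ]
      fin_cases τ <;> simp [rep] at hc ⊢
    refine profile_500 T X' (fun t ht => hS' t ht ▸ hX' t ht) ?_ hsum'
    rw [← Finset.filter_true_of_mem hS']; exact hc4
  · -- slice + (4,0,0)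
    have hS' : ∀ t ∈ T, S' t = {0} ∨ S' t = {0, 1} := by
      intro t ht; obtain ⟨τ, hτ, hc⟩ := hS'ty t ht; rw [hτ]
      fin_cases τ <;> simp [rep] at hc ⊢
    exact profile_400s T X' S' hX' hS' hc0 hc4 hsum'
  · -- (3,2,0)
    have hS' : ∀ t ∈ T, S' t = {0} ∨ S' t = {0, 1} ∨ S' t = {0, 2} ∨ S' t = {2} := by
      intro t ht; obtain ⟨τ, hτ, hc⟩ := hS'ty t ht; rw [hτ]
      fin_cases τ <;> simp [rep] at hc ⊢
    refine line_profile_psi T X' S' hX' hS' hsum' ?_ ?_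
    · rw [Finset.filter_or]; exact (Finset.card_union_le _ _).trans (by omega)
    · refine (Finset.card_le_card ?_).trans ((Finset.card_union_le _ _).trans (add_le_add hc5 hc2))
      intro t ht'
      rw [Finset.mem_filter] at ht'
      rw [Finset.mem_union, Finset.mem_filter, Finset.mem_filter]
      rcases hS' t ht'.1 with h | h | h | h
      · exact absurd (Or.inl h) ht'.2
      · exact absurd (Or.inr h) ht'.2
      · exact Or.inl ⟨ht'.1, h⟩
      · exact Or.inr ⟨ht'.1, h⟩
  · -- slice + (2,2,0)
    have hS' : ∀ t ∈ T, S' t = {0} ∨ S' t = {0, 1} ∨ S' t = {0, 2} ∨ S' t = {2} := by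
      intro t ht; obtain ⟨τ, hτ, hc⟩ := hS'ty t ht; rw [hτ]
      fin_cases τ <;> simp [rep] at hc ⊢
    refine line_profile_psi T X' S' hX' hS' hsum' ?_ ?_
    · rw [Finset.filter_or]; exact (Finset.card_union_le _ _).trans (by omega)
    · refine (Finset.card_le_card ?_).trans ((Finset.card_union_le _ _).trans (add_le_add hc5 hc2))
      intro t ht'
      rw [Finset.mem_filter] at ht'
      rw [Finset.mem_union, Finset.mem_filter, Finset.mem_filter]
      rcases hS' t ht'.1 with h | h | h | h
      · exact absurd (Or.inl h) ht'.2
      · exact absurd (Or.inr h) ht'.2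
      · exact Or.inl ⟨ht'.1, h⟩
      · exact Or.inr ⟨ht'.1, h⟩
  · -- slice at 2 + (3,1) (the relabelled slice + (3,1,0))
    have hS' : ∀ t ∈ T, S' t = {0} ∨ S' t = {0, 1} ∨ S' t = {0, 2} ∨ S' t = {2} := by
      intro t ht; obtain ⟨τ, hτ, hc⟩ := hS'ty t ht; rw [hτ]
      fin_cases τ <;> simp [rep] at hc ⊢
    refine line_profile_psi T X' S' hX' hS' hsum' ?_ ?_
    · rw [Finset.filter_or]; exact (Finset.card_union_le _ _).trans (by omega)
    · refine (Finset.card_le_card ?_).trans ((Finset.card_union_le _ _).trans (add_le_add hc5 hc2))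
      intro t ht'
      rw [Finset.mem_filter] at ht'
      rw [Finset.mem_union, Finset.mem_filter, Finset.mem_filter]
      rcases hS' t ht'.1 with h | h | h | h
      · exact absurd (Or.inl h) ht'.2
      · exact absurd (Or.inr h) ht'.2
      · exact Or.inl ⟨ht'.1, h⟩
      · exact Or.inr ⟨ht'.1, h⟩
  · -- (3,1,1)
    have hS' : ∀ t ∈ T, S' t = {0, 1} ∨ S' t = {0, 2} ∨ S' t = {0, 3} := by
      intro t ht; obtain ⟨τ, hτ, hc⟩ := hS'ty t ht; rw [hτ]
      fin_cases τ <;> simp [rep] at hc ⊢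
    exact profile_311_fin T X' S' hX' hS' hc4 hc5 hc6 hsum'
  · -- slice + (2,1,1)
    have hS' : ∀ t ∈ T, S' t = {0} ∨ S' t = {0, 1} ∨ S' t = {0, 2} ∨ S' t = {0, 3} := by
      intro t ht; obtain ⟨τ, hτ, hc⟩ := hS'ty t ht; rw [hτ]
      fin_cases τ <;> simp [rep] at hc ⊢
    exact profile_211s_fin T X' S' hX' hS' hc0 hc4 hc5 hc6 hsum'
  · -- (4,1,0)
    have hS' : ∀ t ∈ T, S' t = {0, 1} ∨ S' t = {0, 2} := by
      intro t ht; obtain ⟨τ, hτ, hc⟩ := hS'ty t ht; rw [hτ]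
      fin_cases τ <;> simp [rep] at hc ⊢
    exact profile_410_fin T X' S' hX' hS' hc4 hc5 hsum'
  · -- (2,2,1): the hypothesis
    have hS' : ∀ t ∈ T, S' t = {0} ∨ S' t = {0, 1} ∨ S' t = {0, 2} ∨ S' t = {0, 3} := by
      intro t ht; obtain ⟨τ, hτ, hc⟩ := hS'ty t ht; rw [hτ]
      fin_cases τ <;> simp [rep] at hc ⊢
    obtain ⟨f, H, g, h, b, b', c, c', hP⟩ := arrays_of_profile T X' S' hX' hS' 0 2 2 1 hc0 hc4 hc5 hc6 hsum'
    refine H221 g h b b' (c 0) (c' 0) fun v => ?_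
    rw [hP v]
    simp

end LaplaceFourLine

end Summit.ValiantsHypothesis.ValiantsHypothesis.Theorems.RigidityForcesSymmetryRankRigidMinimalRepr
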